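import Literature.NumberTheory.EllipticCurves.PAdicOneVariableEquivarianceOfComparison
import Literature.NumberTheory.GaloisRepresentations.LubinTateComparisonDilationLTCoeff
import Literature.NumberTheory.GaloisRepresentations.LubinTateColemanTraceZeroImage
import Literature.NumberTheory.GaloisRepresentations.LubinTateColemanUnitsLogDeriv
import HarnessLib

/-!
# `p = 2`: de Shalit's Lemma I.3.4 (ii) `μ_{σβ}(σU) = μ_β(U)` for the log-free measure of a NORM-COHERENT UNIT —
# `ν_{σβ}♭(χ(σ)·b) = ν_β♭(b)` on the unit cells, from `δ(σβ) = χ(σ)·(δβ)∘[χ(σ)]` and the dilation transport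

Topic `NumberTheory/EllipticCurves`; namespace `Literature.NumberTheory.EllipticCurves`.

De Shalit, *Iwasawa theory of elliptic curves with complex multiplication* (1987), I.3.4 Lemma (ii): for
`γ ∈ G`, `μ_{γ(β)}(γU) = μ_β(U)`.  On the Coleman side the tree has `δ(σβ) = χ_{π'}(σ)·(δβ) ∘ [χ_{π'}(σ)]_{f'}`
(`NormCoherentUnits.logDeriv_galAct`) and `(h ∘ [v])~ = h̃ ∘ [v]`, `(c·h)~ = c·h̃` (`tildeSer_subst_hom`,
`tildeSer_C_mul`, cf2c-w7); on the measure side `PAdicOneVariableEquivarianceOfComparison.lean` turns a relation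
`h₂ = a·(h₁ ∘ [a]_{f'})` into `ν₂♭(v̄ b) = ν₁♭(b)` (`v = e a`), and `LubinTateComparisonDilationLTCoeff.lean` moves the
relation from the `LTCoeff` currency to `𝒪̂_{F^nr}`.  This file states the result for `β` itself:

* `tildeSer_logDeriv_galAct` — `(δ(σβ))~ = χ(σ) · ((δβ)~ ∘ [χ(σ)]_{f'})` in `𝒪[F]⟦X⟧`;
* ★★★ `restrictUnits_density_unitInv_μ_unitMul_normCoherentUnits_galAct` — for every `σ ∈ Γ_F` and `β ∈ 𝒰`,
  with `H_γ := Θ((δγ)~ ∘ ϑ)` read through any ring map `Θ : 𝒪̂_{F^nr} → 𝕜` compatible with `e : 𝒪[F] → ℤ_2`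
  and `v := e(χ_{π'}(σ))`: **`ν_{σβ}♭(v̄ b) = ν_β♭(b)`** for `ν_γ♭ = restrictUnits (x⁻¹·D_{H_γ})` — the `hν` of
  `GroupDistribution.comap_family_equivariant` for the family `β ↦ ν_β♭` under `Γ_F` acting through `χ_{π'}`.

Everything is proved; no named facts, no definitions, no instances (section-local instance attributes as in the
siblings), no `sorry`.

## References

* [deShalit1987] E. de Shalit, *Iwasawa theory of elliptic curves with complex multiplication* (1987),
  I.2.3 (iv) (p. 14), I.3.4 Lemma (ii) (p. 18).
-/

noncomputable section

open MvPowerSeries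

namespace Literature.NumberTheory.EllipticCurves

section NormCoherentUnitEquivarianceTwo

open ValuativeRel IsLocalRing Field
open Literature.NumberTheory.GaloisRepresentations Literature.NumberTheory.GaloisRepresentations.IsNonarchimedeanLocalField
  Literature.NumberTheory.GaloisRepresentations.LubinTate Literature.NumberTheory.PAdicHodge

variable {F : Type} [Field F] [ValuativeRel F] [TopologicalSpace F] [IsNonarchimedeanLocalField F]

attribute [local instance] ltNormUniformSpace ltNormIsUniformAddGroup rk1 nF nE fintypeResidueField

variable (hq : residueFieldCard F = 2) (h2 : (valuation F).IsUniformizer (((2 : ℕ) : 𝒪[F]) : F))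
  {σ₀ : absoluteGaloisGroup F} (hσ₀ : IsAbsArithFrob σ₀) (u : 𝒪[F]ˣ)
  {ε : (maxUnramifiedCompletion F)ˣ}
  (hε : maxUnramifiedCompletion.galAut F σ₀ (ε : maxUnramifiedCompletion F) =
    algebraMap 𝒪[F] (maxUnramifiedCompletion F) (u : 𝒪[F]) * (ε : maxUnramifiedCompletion F))

/-- **`(δ(σβ))~ = χ_{π'}(σ) · ((δβ)~ ∘ [χ_{π'}(σ)]_{f'})`** in `𝒪[F]⟦X⟧` (`~` de Shalit's log-free twist
`h ↦ h − w·(h ∘ f')`, any `w`). [cite: deShalit1987, I.3.4 Lemma (ii) (p. 18)] -/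
theorem tildeSer_logDeriv_galAct {π' : 𝒪[F]} (hπ' : (valuation F).IsUniformizer (π' : F)) (w : LTCoeff F)
    (σ : absoluteGaloisGroup F) (β : NormCoherentUnits hπ') :
    tildeSer π' w (β.galAct σ).logDeriv =
      PowerSeries.C (LTCoeff.of F (lubinTateChar hπ' σ : 𝒪[F])) *
        (tildeSer π' w β.logDeriv).subst (hom (isLTRing_LTCoeff hπ') (isLTSeries_LTCoeff π')
          (isLTSeries_LTCoeff π') (LTCoeff.of F (lubinTateChar hπ' σ : 𝒪[F]))) := by
  rw [NormCoherentUnits.logDeriv_galAct, tildeSer_C_mul, tildeSer_subst_hom hπ']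

variable {𝕜 : Type*} [NormedField 𝕜] [NormedAlgebra ℚ_[2] 𝕜] [IsUltrametricDist 𝕜] [CompleteSpace 𝕜]
  (Θ : UnrCoeff F →+* 𝕜) (e : 𝒪[F] →+* ℤ_[2]) (hΘe : ∀ a : 𝒪[F], Θ (intToUnrCoeff F a) = padicIntCast 𝕜 (e a))

include hq hΘe in
/-- ★★★ **De Shalit's Lemma I.3.4 (ii) at `p = 2` for the log-free measures**: for `σ ∈ Γ_F`, `β ∈ 𝒰` (tower of
`f' = π'X + X²`, `π' = 2u`), `H_γ := Θ((δγ)~ ∘ ϑ)` and `v := e(χ_{π'}(σ)) ∈ ℤ_2ˣ`: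
**`ν_{σβ}♭(v̄ b) = ν_β♭(b)`** on the unit cells, `ν_γ♭ = restrictUnits (x⁻¹ · D_{H_γ})`.
[cite: deShalit1987, I.3.4 Lemma (ii) (p. 18)] -/
theorem restrictUnits_density_unitInv_μ_unitMul_normCoherentUnits_galAct (σ : absoluteGaloisGroup F)
    (β : NormCoherentUnits (isUniformizer_unit_mul h2 u)) {C : ℝ}
    (hC₁ : ∀ k, ‖PowerSeries.coeff k ((PowerSeries.subst (compSeriesC h2 hσ₀ u hε)
      ((tildeSer ((u : 𝒪[F]) * ((2 : ℕ) : 𝒪[F])) (LTCoeff.of F (u : 𝒪[F])) β.logDeriv).map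
        ((intToUnrCoeff F).comp (LTCoeff.of F).symm.toRingHom))).map Θ)‖ ≤ C)
    (hC₂ : ∀ k, ‖PowerSeries.coeff k ((PowerSeries.subst (compSeriesC h2 hσ₀ u hε)
      ((tildeSer ((u : 𝒪[F]) * ((2 : ℕ) : 𝒪[F])) (LTCoeff.of F (u : 𝒪[F])) (β.galAct σ).logDeriv).map
        ((intToUnrCoeff F).comp (LTCoeff.of F).symm.toRingHom))).map Θ)‖ ≤ C)
    (n : ℕ) (b : ZMod (2 ^ (n + 1))) :
    (restrictUnits ((invAmice₁ 2 ((PowerSeries.subst (compSeriesC h2 hσ₀ u hε)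
        ((tildeSer ((u : 𝒪[F]) * ((2 : ℕ) : 𝒪[F])) (LTCoeff.of F (u : 𝒪[F])) (β.galAct σ).logDeriv).map
          ((intToUnrCoeff F).comp (LTCoeff.of F).symm.toRingHom))).map Θ) hC₂).density
        (ProfiniteTower.padicInt_isUniform 2) (unitInv 𝕜) uniformContinuous_unitInv norm_unitInv_le)).μ n
        (BoundedDistribution.unitMul (BoundedDistribution.unitMod (n + 1)
          (Units.map (e : 𝒪[F] →* ℤ_[2]) (lubinTateChar (isUniformizer_unit_mul h2 u) σ))) b) =
      (restrictUnits ((invAmice₁ 2 ((PowerSeries.subst (compSeriesC h2 hσ₀ u hε)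
        ((tildeSer ((u : 𝒪[F]) * ((2 : ℕ) : 𝒪[F])) (LTCoeff.of F (u : 𝒪[F])) β.logDeriv).map
          ((intToUnrCoeff F).comp (LTCoeff.of F).symm.toRingHom))).map Θ) hC₁).density
        (ProfiniteTower.padicInt_isUniform 2) (unitInv 𝕜) uniformContinuous_unitInv norm_unitInv_le)).μ n b :=
  restrictUnits_density_unitInv_μ_unitMul_of_eq_C_mul_subst_homC' hq h2 hσ₀ u hε Θ e hΘe
    (lubinTateChar (isUniformizer_unit_mul h2 u) σ : 𝒪[F]) _ rfl _ _
    (map_eq_C_mul_subst_homC'_of_eq h2 u (lubinTateChar (isUniformizer_unit_mul h2 u) σ : 𝒪[F]) _ _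
      (tildeSer_logDeriv_galAct (isUniformizer_unit_mul h2 u) (LTCoeff.of F (u : 𝒪[F])) σ β))
    hC₁ hC₂ n b

end NormCoherentUnitEquivarianceTwo

end Literature.NumberTheory.EllipticCurves

end
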